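import Mathlib
import HarnessLib
import Literature.MathematicalPhysics.QuantumLattice.SectorWeightRelativeAngle
import Literature.MathematicalPhysics.QuantumLattice.HubbardSectorCovariance
import Summits.HubbardSuperconductivity.HubbardSuperconductivity.Theorems.KLProgrammeKLRegimeSplitBundleV6

/-!
# Route `KLProgramme` — child `KLRegimeCountertermV7 := CountertermP2 klPredsV7 klWindowC` (stmt-HubbardSuperconductivity-19664):
# the LATTICE-ANGLE NET — every direction is within `4π²/(√(μ+4)·L)` of the polar angle of a lattice momentum whose free energy is
# within `8π/L` of the level `μ` (seat hubbard-kl-k3c3-p3; the child-2 side of defect Δ18 / clause (E3g))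

The one-volume construction of child 2 controls the local part `θ ↦ ν_n(K)(θ)` through the G-objects only at the LATTICE ANGLES
`momentumAngle L k` of momenta `k` in the flat tube (`…CountertermAngularReading` §1, Δ18); with the angular modulus of (E3g)
(`…SplitTwoLegAngular`, `TwoLegAngularG.abs_le_of_net`) the renormalisation condition at EVERY angle follows once the flat-tube lattice
angles form a `δ_L`-net of the circle with `δ_L → 0`.  This module proves that net property for the FREE band on any level
`μ ∈ (-4, 0)` (model-free geometry):

* §1 rounding toward zero (`exists_int_trunc`: `|t| ≤ |r|`, `|t − r| < 1`) and integer sites with `|t_i| < L/2` read as centred momenta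
  `(2π/L)·t` (`torusCentredMomentum_intCast`, no wrap-around);
* §2 energies: `torusBand` through the centred momentum (`torusBand_eq_eps2_torusCentredMomentum`), so a lattice momentum whose centred
  representative is within `δ` of a point of the curve `{ε = μ}` has `|nambuXi L μ k| ≤ 4δ` (`abs_nambuXi_le_of_near`);
* §3 angles: `|arcsin s| ≤ (π/2)|s|`, `|arg w| ≤ (π/2)|Im w|/‖w‖` for `Re w ≥ 0`, and the relative angle of a point within `u/2` of `u·e^{iθ}`
  is at most `π·dist/u` (`abs_arg_mul_exp_neg_le`);
* §4 **`exists_latticeAngle_near`**: for `-4 < μ < 0`, `8π ≤ √(μ+4)·L` and every `θ` there is `k : TorusSite 2 L` with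
  `|nambuXi L μ k| ≤ 8π/L` and `|momentumAngle L k − θ − 2πm| ≤ 4π²/(√(μ+4)·L)` for some `m : ℤ`; on `klWindowC` (`μ ≥ −1.05`,
  `√(μ+4) ≥ 1.7`) and `L ≥ 503` the momentum lies in the flat tube `|ε − μ| ≤ klFlatR = 1/20` (`exists_flatTube_latticeAngle_near`).

Proofs only (no definitions); nothing is asserted about the Hubbard model.  References: BGM 2006 [arXiv:cond-mat/0507686] §2.5 (polar angle of a torus
momentum); HOME/hubbard-kl-k3c3-p3/DEFECT-ANGULAR.md §5 (iii).
-/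

noncomputable section

namespace Summit.HubbardSuperconductivity.HubbardSuperconductivity.Theorems.KLRegimeSplit

set_option linter.dupNamespace false -- summit = problem name (single-conjunct summit), D-0017

open Real Set Complex
open Literature.MathematicalPhysics.QuantumLattice Literature.Probability.LatticeModels
open Literature.MathematicalPhysics.QuantumLattice.BandSectorCounting

/-! ## §1 Rounding toward zero and integer sites read as centred momenta -/

/-- **Rounding toward zero**: every real `r` has an integer `t` with `|t| ≤ |r|` and `|t − r| < 1`. -/
theorem exists_int_trunc (r : ℝ) : ∃ t : ℤ, |(t : ℝ)| ≤ |r| ∧ |(t : ℝ) - r| < 1 := by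
  rcases le_or_gt 0 r with h | h
  · refine ⟨⌊r⌋, ?_, ?_⟩
    · have h1 : (0 : ℝ) ≤ ⌊r⌋ := by exact_mod_cast Int.floor_nonneg.mpr h
      rw [abs_of_nonneg h1, abs_of_nonneg h]
      exact Int.floor_le r
    · rw [abs_lt]; constructor <;> linarith [Int.floor_le r, Int.lt_floor_add_one r]
  · refine ⟨⌈r⌉, ?_, ?_⟩
    · have h1 : (⌈r⌉ : ℝ) ≤ 0 := by exact_mod_cast Int.ceil_le.mpr (by simpa using h.le)
      rw [abs_of_nonpos h1, abs_of_neg h]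
      linarith [Int.le_ceil r]
    · rw [abs_lt]; constructor <;> linarith [Int.le_ceil r, Int.ceil_lt_add_one r]

section Grid

variable (L : ℕ) [NeZero L]

/-- **An integer site with small entries is its own centred representative**: if `|t_i| < L/2` then the centred momentum of the site
`(t_i mod L)_i` is `(2π/L)·t_i` coordinatewise (no wrap-around). -/
theorem torusCentredMomentum_intCast {t : Fin 2 → ℤ} (ht : ∀ i, |((t i : ℤ) : ℝ)| < L / 2) :
    torusCentredMomentum L (fun i => ((t i : ℤ) : ZMod L)) = (fun i => 2 * π / L * ((t i : ℤ) : ℝ)) := by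
  rw [torusCentredMomentum_eq_valMinAbs]
  funext i
  congr 2
  have h := ht i
  have hspec : (((t i : ℤ) : ZMod L)).valMinAbs = t i := by
    rw [ZMod.valMinAbs_spec]
    refine ⟨rfl, ?_, ?_⟩
    · have : -((L : ℝ)) < ((t i : ℤ) : ℝ) * 2 := by rw [abs_lt] at h; linarith [h.1]
      exact_mod_cast this
    · have : ((t i : ℤ) : ℝ) * 2 < (L : ℝ) := by rw [abs_lt] at h; linarith [h.2]
      have : t i * 2 < (L : ℤ) := by exact_mod_cast this
      exact this.le
  rw [hspec]

/-! ## §2 Energies through the centred momentum -/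

omit [NeZero L] in
/-- The torus band read through the centred momentum (`cos` is `2π`-periodic). -/
theorem torusBand_eq_eps2_torusCentredMomentum (k : TorusSite 2 L) :
    torusBand L k = eps2 (torusCentredMomentum L k 0) (torusCentredMomentum L k 1) := by
  have hband : torusBand L k = -2 * (Real.cos (latticeMomentum L k 0) + Real.cos (latticeMomentum L k 1)) := by
    simp only [torusBand, Fin.sum_univ_two]
  rw [hband]
  unfold eps2
  have hc : ∀ i, Real.cos (torusCentredMomentum L k i) = Real.cos (latticeMomentum L k i) := by
    intro i
    have h := self_sub_toIocMod Real.two_pi_pos (-Real.pi) (latticeMomentum L k i)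
    -- `latticeMomentum - centred = z • 2π`
    rw [zsmul_eq_mul] at h
    have : torusCentredMomentum L k i = latticeMomentum L k i -
        (toIocDiv Real.two_pi_pos (-Real.pi) (latticeMomentum L k i) : ℝ) * (2 * π) := by
      unfold torusCentredMomentum; linarith
    rw [this, Real.cos_sub_int_mul_two_pi]
  rw [hc 0, hc 1]

omit [NeZero L] in
/-- **A lattice momentum near a point of the Fermi curve lies in a thin shell**: if `ε(q) = μ` and the centred momentum of `k` is within `δ`
of `q` coordinatewise then `|nambuXi L μ k| ≤ 4δ`. -/
theorem abs_nambuXi_le_of_near {μ δ : ℝ} {q : Fin 2 → ℝ} (hε : eps2 (q 0) (q 1) = μ) {k : TorusSite 2 L}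
    (h : ∀ i, |torusCentredMomentum L k i - q i| ≤ δ) : |nambuXi L μ k| ≤ 4 * δ := by
  unfold nambuXi
  rw [torusBand_eq_eps2_torusCentredMomentum, ← hε]
  have h' := abs_eps2_sub_eps2_le (torusCentredMomentum L k 0) (torusCentredMomentum L k 1) (q 0) (q 1)
  have h0 := h 0
  have h1 := h 1
  linarith

end Grid

/-! ## §3 Angles -/

/-- `|arcsin s| ≤ (π/2)·|s|` (Jordan's inequality read backwards). -/
theorem abs_arcsin_le_pi_div_two_mul_abs (s : ℝ) : |Real.arcsin s| ≤ π / 2 * |s| := by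
  -- the nonnegative case
  have key : ∀ t : ℝ, 0 ≤ t → Real.arcsin t ≤ π / 2 * t := by
    intro t ht
    rcases le_or_gt t 1 with ht1 | ht1
    · have hsin : t ≤ Real.sin (π / 2 * t) := Real.le_sin_mul ht ht1
      have hmem : π / 2 * t ∈ Icc (-(π / 2)) (π / 2) := by
        constructor <;> nlinarith [pi_pos]
      calc Real.arcsin t ≤ Real.arcsin (Real.sin (π / 2 * t)) := Real.arcsin_le_arcsin hsin
        _ = π / 2 * t := Real.arcsin_sin hmem.1 hmem.2
    · rw [Real.arcsin_of_one_le ht1.le]; nlinarith [pi_pos]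
  rcases le_or_gt 0 s with hs | hs
  · rw [abs_of_nonneg (Real.arcsin_nonneg.mpr hs), abs_of_nonneg hs]; exact key s hs
  · have hs' : 0 ≤ -s := by linarith
    rw [abs_of_neg (Real.arcsin_lt_zero.mpr hs), abs_of_neg hs, ← Real.arcsin_neg]
    exact key (-s) hs'

/-- For `Re w ≥ 0`: `|arg w| ≤ (π/2)·|Im w|/‖w‖`. -/
theorem abs_arg_le_of_re_nonneg {w : ℂ} (hw : 0 ≤ w.re) : |arg w| ≤ π / 2 * (|w.im| / ‖w‖) := by
  rw [arg_of_re_nonneg hw]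
  refine (abs_arcsin_le_pi_div_two_mul_abs _).trans ?_
  rw [abs_div, abs_norm]

/-- **The relative angle of a point near `u·e^{iθ}`**: if `‖z − u·e^{iθ}‖ ≤ u/2` (`u > 0`) then `|arg(z e^{-iθ})| ≤ π·‖z − u·e^{iθ}‖/u`. -/
theorem abs_arg_mul_exp_neg_le {u θ : ℝ} (hu : 0 < u) {z : ℂ} (hz : ‖z - u * exp (θ * I)‖ ≤ u / 2) :
    |arg (z * exp (-(θ * I)))| ≤ π * ‖z - u * exp (θ * I)‖ / u := by
  set d : ℂ := z - u * exp (θ * I) with hd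
  set w : ℂ := z * exp (-(θ * I)) with hw
  have hexp : exp (θ * I) * exp (-(θ * I)) = 1 := by rw [← Complex.exp_add]; simp
  have hw' : w = u + d * exp (-(θ * I)) := by
    rw [hw, hd, sub_mul, mul_assoc, hexp]; ring
  have hnd : ‖d * exp (-(θ * I))‖ = ‖d‖ := by
    rw [norm_mul, show -(θ * I) = ((-θ : ℝ) : ℂ) * I by push_cast; ring, Complex.norm_exp_ofReal_mul_I, mul_one]
  -- real and imaginary parts of `w`
  have hre : u / 2 ≤ w.re := by
    rw [hw']
    simp only [add_re, ofReal_re]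
    have := abs_re_le_norm (d * exp (-(θ * I)))
    rw [hnd] at this
    have := neg_abs_le (d * exp (-(θ * I))).re
    linarith
  have him : |w.im| ≤ ‖d‖ := by
    rw [hw']
    simp only [add_im, ofReal_im, zero_add]
    have := abs_im_le_norm (d * exp (-(θ * I)))
    rwa [hnd] at this
  have hwpos : 0 < ‖w‖ := by
    have := abs_re_le_norm w
    have : u / 2 ≤ ‖w‖ := hre.trans ((le_abs_self _).trans this)
    linarith
  have hwre : 0 ≤ w.re := by linarith
  calc |arg w| ≤ π / 2 * (|w.im| / ‖w‖) := abs_arg_le_of_re_nonneg hwre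
    _ ≤ π / 2 * (‖d‖ / (u / 2)) := by
        have hwn : u / 2 ≤ ‖w‖ := hre.trans ((le_abs_self _).trans (abs_re_le_norm w))
        gcongr
    _ = π * ‖d‖ / u := by field_simp

/-! ## §4 The net of lattice angles on a level of the free band -/

/-- The free Fermi point at angle `θ` as a complex number: `X + iY = u·e^{iθ}`. -/
theorem momToComplex_bandXY (μ θ : ℝ) :
    momToComplex ![bandX μ θ, bandY μ θ] = bandFermiRadius μ θ * exp (θ * I) := by
  apply Complex.ext
  · simp [bandX, Complex.exp_ofReal_mul_I_re]
  · simp [bandY, Complex.exp_ofReal_mul_I_im]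

/-- **The lattice-angle net.**  For a level `-4 < μ < 0` and a side `L` with `8π ≤ √(μ+4)·L`, every direction `θ` is within
`4π²/(√(μ+4)·L)` (mod `2π`) of the polar angle of a lattice momentum whose free energy is within `8π/L` of `μ`. -/
theorem exists_latticeAngle_near {μ : ℝ} (hμ₁ : -4 < μ) (hμ₂ : μ < 0) (L : ℕ) [NeZero L]
    (hL : 8 * π ≤ Real.sqrt (μ + 4) * L) (θ : ℝ) :
    ∃ k : TorusSite 2 L, |nambuXi L μ k| ≤ 8 * π / L ∧
      ∃ m : ℤ, |momentumAngle L k - θ - 2 * π * m| ≤ 4 * π ^ 2 / (Real.sqrt (μ + 4) * L) := by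
  have hL0 : (0 : ℝ) < L := Nat.cast_pos.2 (Nat.pos_of_ne_zero (NeZero.ne L))
  have h2πL : (0 : ℝ) < 2 * π / L := by positivity
  -- the free Fermi point on the ray
  set q : Fin 2 → ℝ := ![bandX μ θ, bandY μ θ] with hq_def
  have hq : ∀ i, |q i| < π := by
    intro i; fin_cases i
    · simpa [hq_def] using abs_bandX_lt_pi hμ₁ hμ₂ θ
    · simpa [hq_def] using abs_bandY_lt_pi hμ₁ hμ₂ θ
  have hε : eps2 (q 0) (q 1) = μ := by
    have := sqDispersion_vec_bandXY hμ₁ hμ₂ θ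
    simpa [hq_def, sqDispersion_eq_eps2] using this
  set u : ℝ := bandFermiRadius μ θ with hu_def
  have hs0 : 0 < Real.sqrt (μ + 4) := Real.sqrt_pos.2 (by linarith)
  have hsu : Real.sqrt (μ + 4) ≤ u := sqrt_le_bandFermiRadius hμ₁ hμ₂ θ
  have hu : 0 < u := hs0.trans_le hsu
  -- round the grid coordinates of `q` toward zero
  have hround : ∀ i, ∃ t : ℤ, |(t : ℝ)| ≤ |q i * L / (2 * π)| ∧ |(t : ℝ) - q i * L / (2 * π)| < 1 := fun i =>
    exists_int_trunc _
  choose t ht using hround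
  have htL : ∀ i, |((t i : ℤ) : ℝ)| < L / 2 := by
    intro i
    refine (ht i).1.trans_lt ?_
    rw [abs_div, abs_mul, abs_of_pos hL0, abs_of_pos two_pi_pos, div_lt_iff₀ two_pi_pos]
    nlinarith [hq i, pi_pos]
  set k : TorusSite 2 L := fun i => ((t i : ℤ) : ZMod L) with hk_def
  have hc : torusCentredMomentum L k = fun i => 2 * π / L * ((t i : ℤ) : ℝ) := torusCentredMomentum_intCast L htL
  -- the centred momentum is within `2π/L` of `q`, coordinatewise
  have hnear : ∀ i, |torusCentredMomentum L k i - q i| ≤ 2 * π / L := by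
    intro i
    rw [hc]
    have hq' : q i = 2 * π / L * (q i * L / (2 * π)) := by field_simp
    show |2 * π / L * ((t i : ℤ) : ℝ) - q i| ≤ 2 * π / L
    rw [hq', ← mul_sub, abs_mul, abs_of_pos h2πL]
    calc 2 * π / L * |((t i : ℤ) : ℝ) - q i * L / (2 * π)| ≤ 2 * π / L * 1 :=
          mul_le_mul_of_nonneg_left (ht i).2.le h2πL.le
      _ = 2 * π / L := mul_one _
  refine ⟨k, ?_, ?_⟩
  · have := abs_nambuXi_le_of_near L hε hnear
    calc |nambuXi L μ k| ≤ 4 * (2 * π / L) := this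
      _ = 8 * π / L := by ring
  -- the centred momentum and its distance to `q` as complex numbers
  set c : Fin 2 → ℝ := torusCentredMomentum L k with hc_def
  have hdist : ‖momToComplex c - u * exp (θ * I)‖ ≤ 4 * π / L := by
    have hz : momToComplex c - u * exp (θ * I) = momToComplex c - momToComplex q := by
      rw [hu_def, ← momToComplex_bandXY]
    rw [hz]
    have hre : (momToComplex c - momToComplex q).re = c 0 - q 0 := by simp
    have him : (momToComplex c - momToComplex q).im = c 1 - q 1 := by simp
    calc ‖momToComplex c - momToComplex q‖
        ≤ |(momToComplex c - momToComplex q).re| + |(momToComplex c - momToComplex q).im| := norm_le_abs_re_add_abs_im _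
      _ = |c 0 - q 0| + |c 1 - q 1| := by rw [hre, him]
      _ ≤ 2 * π / L + 2 * π / L := add_le_add (hnear 0) (hnear 1)
      _ = 4 * π / L := by ring
  have hhalf : ‖momToComplex c - u * exp (θ * I)‖ ≤ u / 2 := by
    refine hdist.trans ?_
    rw [div_le_div_iff₀ hL0 (by norm_num : (0:ℝ) < 2)]
    nlinarith
  -- `c ≠ 0`
  have hc0 : c ≠ 0 := by
    intro h0
    have : momToComplex c = 0 := (momToComplex_eq_zero_iff c).2 h0
    rw [this, zero_sub, norm_neg, norm_mul, Complex.norm_exp_ofReal_mul_I, mul_one, Complex.norm_real, Real.norm_eq_abs,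
      abs_of_pos hu] at hhalf
    linarith
  -- the polar angle through the relative angle
  obtain ⟨m, hm⟩ := polarAngle_eq_add_sectorRelAngle θ hc0
  refine ⟨m, ?_⟩
  have hang : |sectorRelAngle θ c| ≤ π * ‖momToComplex c - u * exp (θ * I)‖ / u :=
    abs_arg_mul_exp_neg_le hu hhalf
  have : momentumAngle L k - θ - 2 * π * m = sectorRelAngle θ c := by
    show polarAngle c - θ - 2 * π * m = sectorRelAngle θ c
    rw [hm]; ring
  rw [this]
  refine hang.trans ?_
  calc π * ‖momToComplex c - u * exp (θ * I)‖ / u ≤ π * (4 * π / L) / u := by gcongr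
    _ = 4 * π ^ 2 / (u * L) := by field_simp
    _ ≤ 4 * π ^ 2 / (Real.sqrt (μ + 4) * L) := by
        apply div_le_div_of_nonneg_left (by positivity) (by positivity)
        exact mul_le_mul_of_nonneg_right hsu hL0.le

/-- **On the analysis window the net sits in the flat tube.**  For `μ ∈ klWindowC` (so `√(μ+4) ≥ 1.7`) and `L ≥ 503`: every direction is
within `(4π²/1.7)/L ≤ 24/L` of the polar angle of a lattice momentum with `|nambuXi L μ k| ≤ klFlatR` (= `1/20`, where `klFlatCutoff = 1`). -/
theorem exists_flatTube_latticeAngle_near {μ : ℝ} (hμ : μ ∈ klWindowC) (L : ℕ) [NeZero L] (hL : 503 ≤ L) (θ : ℝ) :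
    ∃ k : TorusSite 2 L, |nambuXi L μ k| ≤ klFlatR ∧ ∃ m : ℤ, |momentumAngle L k - θ - 2 * π * m| ≤ 24 / L := by
  have hμ₁ : -4 < μ := by have := hμ.1; norm_num at this ⊢; linarith
  have hμ₂ : μ < 0 := by have := hμ.2; linarith
  have hL0 : (0 : ℝ) < L := Nat.cast_pos.2 (Nat.pos_of_ne_zero (NeZero.ne L))
  have hLr : (503 : ℝ) ≤ L := by exact_mod_cast hL
  have hs : (1.7 : ℝ) ≤ Real.sqrt (μ + 4) := by
    rw [show (1.7 : ℝ) = Real.sqrt (1.7 ^ 2) by rw [Real.sqrt_sq]; norm_num]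
    exact Real.sqrt_le_sqrt (by have := hμ.1; norm_num at this ⊢; linarith)
  have hπ := Real.pi_lt_d4 -- π < 3.1416
  have hπ0 := Real.pi_pos
  have hπ2 : π ^ 2 < 9.87 := by nlinarith
  have hcond : 8 * π ≤ Real.sqrt (μ + 4) * L := by nlinarith
  obtain ⟨k, hk, m, hm⟩ := exists_latticeAngle_near hμ₁ hμ₂ L hcond θ
  refine ⟨k, hk.trans ?_, m, hm.trans ?_⟩
  · rw [klFlatR, div_le_div_iff₀ hL0 (by norm_num)]
    nlinarith
  · rw [div_le_div_iff₀ (by positivity) hL0]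
    have : 4 * π ^ 2 * L ≤ 24 * (1.7 * L) := by nlinarith
    calc 4 * π ^ 2 * (L : ℝ) ≤ 24 * (1.7 * L) := this
      _ ≤ 24 * (Real.sqrt (μ + 4) * L) := by gcongr

end Summit.HubbardSuperconductivity.HubbardSuperconductivity.Theorems.KLRegimeSplit

end
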